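import Mathlib
import Summits.Ventures.HodgeRepro.Tier4.Line1.WittPlane
import Summits.Ventures.HodgeRepro.Tier4.Line1.IntegralWitt

/-!
# Tier4/Line1/IntegralWittIsometry — LINE L1, rung C7.2a (second module): the INTEGRAL ISOMETRY

Blind re-derivation cell `pub-hodge-repro`, Tier 4 (README §9–§10), seat t4-L1-p1 g2 (STATUS.md S13090).  Step 2 of
integral Witt for the hermitian plane: given the integral unit-norm orthogonal vector `x′` of
`IntegralWitt.exists_orth_unit` (Step 1, module `Tier4/Line1/IntegralWitt`), t4-L1-p3's `SU(2)`-type construction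
`h = S R S⁻¹` on the adapted basis `S = (x, Om x, x′, Om x′)` (WittPlane p670389, `Rot.witt_isometry` / `Rot.witt_comm_J`
/ `Rot.gram_adapted` / `Rot.mul_adapted_eq` by name) is INTEGRAL: `det S² · det B = det G = d² α² α′²` is a unit, so
`det S` is a unit and `S⁻¹ = (det S)⁻¹ adj S` is integral; `c = S⁻¹ y`, `ν = ±c·α′/α` and `R` are integral.  The same
`x′` serves `x` and `y`, so no norm-class matching enters.  `exists_integral_isometry_mulVec_eq` is the column picture,
`exists_integral_isometry_vecMul_eq` the row picture of typer-2's `unitaryGroup` / p4's `localU` (`γ Ω = Ω γ`,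
`γ B γᵀ = B`, `x γ = y`), consumed by the place instantiation C7.2c.

Nothing here says anything about the status of the Hodge conjecture for CM abelian varieties, which is NOT proved
(HC_CM is NOT proved by anyone in this repository).
-/

set_option autoImplicit false

noncomputable section

namespace Summit.Ventures.HodgeRepro.Tier4.Line1.IntWitt

open Matrix

variable {F : Type} [Field F] {𝓞 : ValuationSubring F}

/-! ## Step 2 — the integral isometry (p3's `SU(2)`-type construction with the integrality tracked) -/

section Step2

variable [CharZero F]

/-- **INTEGRAL WITT FOR THE HERMITIAN PLANE, column picture**: over a field `F` with a valuation subring `𝓞`, for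
column-hermitian data `(B, Om, d)` with integral entries, `det B` and `d` units and `2⁻¹ ∈ 𝓞`, two INTEGRAL vectors
`x`, `y` of the same UNIT norm are related by an `Om`-linear `B`-isometry with INTEGRAL entries.  The construction is
t4-L1-p3's `Rot.exists_isometry_mulVec_eq` (WittPlane p670389) verbatim — `h = S R S⁻¹` on the adapted basis
`S = (x, Om x, x′, Om x′)` — with `x′` the integral unit-norm orthogonal vector of `exists_orth_unit`, which makes
`det S` a unit and every matrix in sight integral. -/
theorem exists_integral_isometry_mulVec_eq {B Om : Matrix (Fin 4) (Fin 4) F} {d : F} (hB : Bᵀ = B)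
    (hherm : Omᵀ * B = -(B * Om)) (hOm : Om * Om = -(d • (1 : Matrix (Fin 4) (Fin 4) F)))
    (hBint : ∀ i j, B i j ∈ 𝓞) (hOmint : ∀ i j, Om i j ∈ 𝓞)
    (hdet : IsUnitIn 𝓞 B.det) (hd : IsUnitIn 𝓞 d) (h2 : (2 : F)⁻¹ ∈ 𝓞)
    {x y : Fin 4 → F} (hx : ∀ i, x i ∈ 𝓞) (hy : ∀ i, y i ∈ 𝓞)
    (hα : IsUnitIn 𝓞 (x ⬝ᵥ (B *ᵥ x))) (hxy : x ⬝ᵥ (B *ᵥ x) = y ⬝ᵥ (B *ᵥ y)) :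
    ∃ h : Matrix (Fin 4) (Fin 4) F, (∀ i j, h i j ∈ 𝓞) ∧ h * Om = Om * h ∧ hᵀ * B * h = B ∧
      h *ᵥ x = y := by
  obtain ⟨x', hx'int, hx'x, hx'Ox, hα'⟩ :=
    exists_orth_unit hB hherm hOm hBint hOmint hdet hd h2 hx hα
  have hxx' : x ⬝ᵥ (B *ᵥ x') = 0 := by rw [Rot.pair_comm hB]; exact hx'x
  have hxOx' : x ⬝ᵥ (B *ᵥ (Om *ᵥ x')) = 0 := by
    rw [← neg_eq_zero, ← Rot.pair_mulVec_left hherm, Rot.pair_comm hB]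
    exact hx'Ox
  set S : Matrix (Fin 4) (Fin 4) F := Matrix.of fun i j => ![x, Om *ᵥ x, x', Om *ᵥ x'] j i with hSdef
  set G : Matrix (Fin 4) (Fin 4) F :=
    Matrix.diagonal ![x ⬝ᵥ (B *ᵥ x), d * (x ⬝ᵥ (B *ᵥ x)), x' ⬝ᵥ (B *ᵥ x'), d * (x' ⬝ᵥ (B *ᵥ x'))]
    with hGdef
  have hG : Sᵀ * B * S = G := Rot.gram_adapted hB hherm hOm x x' hxx' hxOx'
  have hα0 : x ⬝ᵥ (B *ᵥ x) ≠ 0 := hα.ne_zero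
  -- `S` is integral
  have hOx_mem : ∀ i, (Om *ᵥ x) i ∈ 𝓞 := fun i => mulVec_mem hOmint hx i
  have hOx'_mem : ∀ i, (Om *ᵥ x') i ∈ 𝓞 := fun i => mulVec_mem hOmint hx'int i
  have hSint : ∀ i j, S i j ∈ 𝓞 := by
    intro i j
    simp only [S, Matrix.of_apply]
    fin_cases j <;> simp [hx, hOx_mem, hx'int, hOx'_mem]
  -- `det G` is a unit, hence `det S` is a unit: `det S² · det B = det G`
  have hGdet : G.det = (x ⬝ᵥ (B *ᵥ x)) * (d * (x ⬝ᵥ (B *ᵥ x))) * (x' ⬝ᵥ (B *ᵥ x')) *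
      (d * (x' ⬝ᵥ (B *ᵥ x'))) := by
    rw [hGdef, Matrix.det_diagonal, Fin.prod_univ_four]
    simp
  have hGunit : IsUnitIn 𝓞 G.det := by
    rw [hGdet]
    exact ((hα.mul (hd.mul hα)).mul hα').mul (hd.mul hα')
  have hSdet2 : S.det * S.det * B.det = G.det := by
    rw [← hG, Matrix.det_mul, Matrix.det_mul, Matrix.det_transpose]
    ring
  have hSdet : IsUnitIn 𝓞 S.det := by
    have hSmem : S.det ∈ 𝓞 := det_mem hSint
    have h1 : IsUnitIn 𝓞 (S.det * S.det * B.det) := by rw [hSdet2]; exact hGunit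
    exact IsUnitIn.of_mul_mem hSmem hSmem (IsUnitIn.of_mul_mem (mul_mem hSmem hSmem) hdet.mem h1)
  have hSdetU : IsUnit S.det := isUnit_iff_ne_zero.mpr hSdet.ne_zero
  have hSS : S * S⁻¹ = 1 := Matrix.mul_nonsing_inv S hSdetU
  have hSS' : S⁻¹ * S = 1 := Matrix.nonsing_inv_mul S hSdetU
  have hSinv_int : ∀ i j, S⁻¹ i j ∈ 𝓞 := inv_mem hSint hSdet
  have hOmS : Om * S = S * Matrix.of ![![0, -d, 0, 0], ![1, 0, 0, 0], ![0, 0, 0, -d], ![0, 0, 1, 0]] :=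
    Rot.mul_adapted_eq hOm x x'
  -- the coordinates of `y` on the adapted basis
  set c : Fin 4 → F := S⁻¹ *ᵥ y with hcdef
  have hc_mem : ∀ i, c i ∈ 𝓞 := fun i => mulVec_mem hSinv_int hy i
  have hyc : S *ᵥ c = y := by rw [hcdef, mulVec_mulVec, hSS, one_mulVec]
  -- the constraint `cᵀ G c = β(y, y) = β(x, x)`
  have hconstr : c 0 * c 0 * (x ⬝ᵥ (B *ᵥ x)) + d * (c 1 * c 1) * (x ⬝ᵥ (B *ᵥ x)) +
      c 2 * c 2 * (x' ⬝ᵥ (B *ᵥ x')) + d * (c 3 * c 3) * (x' ⬝ᵥ (B *ᵥ x')) = x ⬝ᵥ (B *ᵥ x) := by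
    have h1 : y ⬝ᵥ (B *ᵥ y) = c ⬝ᵥ (G *ᵥ c) := by
      rw [← hyc, ← hG]
      calc (S *ᵥ c) ⬝ᵥ (B *ᵥ (S *ᵥ c)) = (c ᵥ* Sᵀ) ⬝ᵥ (B *ᵥ (S *ᵥ c)) := by rw [vecMul_transpose]
        _ = c ⬝ᵥ (Sᵀ *ᵥ (B *ᵥ (S *ᵥ c))) := by rw [← dotProduct_mulVec]
        _ = c ⬝ᵥ ((Sᵀ * B * S) *ᵥ c) := by simp only [mulVec_mulVec, Matrix.mul_assoc]
    have h2' : c ⬝ᵥ (G *ᵥ c) = c 0 * c 0 * (x ⬝ᵥ (B *ᵥ x)) + d * (c 1 * c 1) * (x ⬝ᵥ (B *ᵥ x)) +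
        c 2 * c 2 * (x' ⬝ᵥ (B *ᵥ x')) + d * (c 3 * c 3) * (x' ⬝ᵥ (B *ᵥ x')) := by
      rw [hGdef, Rot.dotProduct_diagonal_mulVec]
      ring
    rw [← h2', ← h1]
    exact hxy.symm
  set ν₁ : F := -(c 2 * (x' ⬝ᵥ (B *ᵥ x'))) / (x ⬝ᵥ (B *ᵥ x)) with hν₁def
  set ν₂ : F := c 3 * (x' ⬝ᵥ (B *ᵥ x')) / (x ⬝ᵥ (B *ᵥ x)) with hν₂def
  have hν₁ : ν₁ * (x ⬝ᵥ (B *ᵥ x)) = -(c 2 * (x' ⬝ᵥ (B *ᵥ x'))) := by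
    rw [hν₁def, div_mul_cancel₀ _ hα0]
  have hν₂ : ν₂ * (x ⬝ᵥ (B *ᵥ x)) = c 3 * (x' ⬝ᵥ (B *ᵥ x')) := by
    rw [hν₂def, div_mul_cancel₀ _ hα0]
  have hν₁_mem : ν₁ ∈ 𝓞 := by
    rw [hν₁def, div_eq_mul_inv]
    exact mul_mem (neg_mem (mul_mem (hc_mem 2) hα'.mem)) hα.inv_mem
  have hν₂_mem : ν₂ ∈ 𝓞 := by
    rw [hν₂def, div_eq_mul_inv]
    exact mul_mem (mul_mem (hc_mem 3) hα'.mem) hα.inv_mem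
  set R : Matrix (Fin 4) (Fin 4) F := Matrix.of
    ![![c 0, -(d * c 1), ν₁, -(d * ν₂)], ![c 1, c 0, ν₂, ν₁], ![c 2, -(d * c 3), c 0, d * c 1],
      ![c 3, c 2, -(c 1), c 0]] with hRdef
  have hRint : ∀ i j, R i j ∈ 𝓞 := by
    intro i j
    simp only [R, Matrix.of_apply]
    fin_cases i <;> fin_cases j <;>
      simp [hc_mem, hν₁_mem, hν₂_mem, hd.mem, mul_mem]
  have hRG : Rᵀ * G * R = G := Rot.witt_isometry hα0 hconstr hν₁ hν₂
  have hRJ : R * Matrix.of ![![0, -d, 0, 0], ![1, 0, 0, 0], ![0, 0, 0, -d], ![0, 0, 1, 0]] =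
      Matrix.of ![![0, -d, 0, 0], ![1, 0, 0, 0], ![0, 0, 0, -d], ![0, 0, 1, 0]] * R :=
    Rot.witt_comm_J _ _ _ _ _ _ _
  have hRc : R *ᵥ Pi.single 0 1 = c := by
    rw [mulVec_single_one]
    ext i
    fin_cases i <;> simp [R]
  have hcan : ∀ X : Matrix (Fin 4) (Fin 4) F, S⁻¹ * (S * X) = X := fun X => by
    rw [← Matrix.mul_assoc, hSS', Matrix.one_mul]
  have hcanT : ∀ X : Matrix (Fin 4) (Fin 4) F, Sᵀ * (S⁻¹ᵀ * X) = X := fun X => by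
    rw [← Matrix.mul_assoc, ← Matrix.transpose_mul, hSS', Matrix.transpose_one, Matrix.one_mul]
  refine ⟨S * R * S⁻¹, fun i j => mul_mem_mat (mul_mem_mat hSint hRint) hSinv_int i j, ?_, ?_, ?_⟩
  · have hOm' : Om = S * Matrix.of ![![0, -d, 0, 0], ![1, 0, 0, 0], ![0, 0, 0, -d], ![0, 0, 1, 0]] * S⁻¹ := by
      rw [← hOmS, Matrix.mul_assoc, hSS, Matrix.mul_one]
    rw [hOm']
    simp only [Matrix.mul_assoc, hcan]
    rw [← Matrix.mul_assoc R, hRJ, Matrix.mul_assoc]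
  · have hB' : B = S⁻¹ᵀ * G * S⁻¹ := by
      rw [← hG]
      calc B = (S⁻¹ᵀ * Sᵀ) * B * (S * S⁻¹) := by
            rw [← Matrix.transpose_mul, hSS, Matrix.transpose_one, Matrix.one_mul, Matrix.mul_one]
        _ = S⁻¹ᵀ * (Sᵀ * B * S) * S⁻¹ := by simp only [Matrix.mul_assoc]
    have key : S⁻¹ᵀ * (Rᵀ * (G * (R * S⁻¹))) = S⁻¹ᵀ * (G * S⁻¹) := by
      calc S⁻¹ᵀ * (Rᵀ * (G * (R * S⁻¹))) = S⁻¹ᵀ * ((Rᵀ * G * R) * S⁻¹) := by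
            simp only [Matrix.mul_assoc]
        _ = S⁻¹ᵀ * (G * S⁻¹) := by rw [hRG]
    rw [Matrix.transpose_mul, Matrix.transpose_mul, hB']
    simp only [Matrix.mul_assoc, hcan, hcanT]
    exact key
  · have hx' : S *ᵥ Pi.single 0 1 = x := by
      rw [mulVec_single_one]
      rfl
    have hSx : S⁻¹ *ᵥ x = Pi.single 0 1 := by
      rw [← hx', mulVec_mulVec, hSS', one_mulVec]
    rw [← mulVec_mulVec x (S * R) S⁻¹, hSx, ← mulVec_mulVec, hRc, hyc]

/-- **INTEGRAL WITT, row picture** (the convention of typer-2's `unitaryGroup` and p4's `localU`): for row-genuine data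
`Ω B = −B Ωᵀ`, `Ω² = −d` with integral entries, `det B`, `d` units, `2⁻¹ ∈ 𝓞`, and integral row vectors `x`, `y` with
`x B xᵀ = y B yᵀ` a unit, there is an integral `γ` with `γ Ω = Ω γ`, `γ B γᵀ = B` and `x γ = y`. -/
theorem exists_integral_isometry_vecMul_eq {B Ω : Matrix (Fin 4) (Fin 4) F} {d : F} (hB : Bᵀ = B)
    (hrow : Ω * B = -(B * Ωᵀ)) (hΩ : Ω * Ω = -(d • (1 : Matrix (Fin 4) (Fin 4) F)))
    (hBint : ∀ i j, B i j ∈ 𝓞) (hΩint : ∀ i j, Ω i j ∈ 𝓞)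
    (hdet : IsUnitIn 𝓞 B.det) (hd : IsUnitIn 𝓞 d) (h2 : (2 : F)⁻¹ ∈ 𝓞)
    {x y : Fin 4 → F} (hx : ∀ i, x i ∈ 𝓞) (hy : ∀ i, y i ∈ 𝓞)
    (hα : IsUnitIn 𝓞 ((x ᵥ* B) ⬝ᵥ x)) (hxy : (x ᵥ* B) ⬝ᵥ x = (y ᵥ* B) ⬝ᵥ y) :
    ∃ γ : Matrix (Fin 4) (Fin 4) F, (∀ i j, γ i j ∈ 𝓞) ∧ γ * Ω = Ω * γ ∧ γ * B * γᵀ = B ∧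
      x ᵥ* γ = y := by
  -- the column picture with `Om := Ωᵀ`
  have hOm : Ωᵀ * Ωᵀ = -(d • (1 : Matrix (Fin 4) (Fin 4) F)) := by
    rw [← Matrix.transpose_mul, hΩ, Matrix.transpose_neg, Matrix.transpose_smul, Matrix.transpose_one]
  have hherm : Ωᵀᵀ * B = -(B * Ωᵀ) := by
    rw [Matrix.transpose_transpose]
    exact hrow
  have e : ∀ v : Fin 4 → F, (v ᵥ* B) ⬝ᵥ v = v ⬝ᵥ (B *ᵥ v) := by
    intro v
    rw [← mulVec_transpose, hB, dotProduct_comm]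
  have hα' : IsUnitIn 𝓞 (x ⬝ᵥ (B *ᵥ x)) := by rw [← e]; exact hα
  have hxy' : x ⬝ᵥ (B *ᵥ x) = y ⬝ᵥ (B *ᵥ y) := by rw [← e, ← e]; exact hxy
  obtain ⟨h, hint, hhOm, hhB, hhx⟩ :=
    exists_integral_isometry_mulVec_eq hB hherm hOm hBint (transpose_mem hΩint) hdet hd h2 hx hy hα' hxy'
  refine ⟨hᵀ, transpose_mem hint, ?_, ?_, ?_⟩
  · rw [← Matrix.transpose_transpose Ω, ← Matrix.transpose_mul, ← Matrix.transpose_mul, hhOm]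
  · rw [Matrix.transpose_transpose]
    exact hhB
  · rw [vecMul_transpose, hhx]

end Step2

end Summit.Ventures.HodgeRepro.Tier4.Line1.IntWitt

end
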